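import Summits.Ventures.PercRepro2.CaseOneGadgetUWOBPolyT

/-!
# The gadget `u ~ {w, o, b}`, `w ~ {u, a₁, a₂}`: the parts of the T-pair masses
(blind cell PercRepro2, p1 g31; the first stage of the gadget pipeline for the T-forms)

`sgT` and `sgTo` are multilinear in the three edge weights of the `u`-side `e₀, e₁, e₂`; their parts
`pgT_abc` / `pgTo_abc` are polynomials in `e₃, e₄` and the cells (**`sgT_parts`**, **`sgTo_parts`**, the
shape of `sgQ_parts`). Own code; standard axioms. -/

namespace Summit.Ventures.PercRepro2

namespace CaseOne

section PartsTG5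
variable {R : Type*} [CommRing R]

/-- The `e₀^0 e₁^0 e₂^1` part of the mass `T`. -/
def pgT001 (e₃ e₄ : R) (m : SCells R) : R :=
  (-1 : R) * e₃ * e₄ * m.c8 + (-1 : R) * e₃ * e₄ * m.c5 + (-1 : R) * e₃ * e₄ * m.c2 + (1 : R) * m.c8 + (1 : R) * m.c5 + (1 : R) * m.c2

/-- The `e₀^0 e₁^1 e₂^0` part of the mass `T`. -/
def pgT010 (e₃ e₄ : R) (m : SCells R) : R :=
  (-1 : R) * e₃ * e₄ * m.c8 + (-1 : R) * e₃ * e₄ * m.c7 + (-1 : R) * e₃ * e₄ * m.c6 + (1 : R) * m.c8 + (1 : R) * m.c7 + (1 : R) * m.c6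

/-- The `e₀^0 e₁^1 e₂^1` part of the mass `T`. -/
def pgT011 (e₃ e₄ : R) (m : SCells R) : R :=
  (1 : R) * e₃ * e₄ * m.c8 + (1 : R) * e₃ * e₄ * m.c7 + (1 : R) * e₃ * e₄ * m.c5 + (-1 : R) * m.c8 + (-1 : R) * m.c7 + (-1 : R) * m.c5

/-- The `e₀^1 e₁^0 e₂^0` part of the mass `T`. -/
def pgT100 (e₃ e₄ : R) (m : SCells R) : R :=
  (-1 : R) * e₃ * e₄ * m.c10 + (-1 : R) * e₃ * e₄ * m.c9 + (-1 : R) * e₃ * e₄ * m.c8 + (-1 : R) * e₃ * e₄ * m.c7 + (-1 : R) * e₃ * e₄ * m.c6 + (-1 : R) * e₃ * e₄ * m.c5 + (-1 : R) * e₃ * e₄ * m.c4 + (-1 : R) * e₃ * e₄ * m.c3 + (-1 : R) * e₃ * e₄ * m.c2 + (-1 : R) * e₃ * e₄ * m.c1 + (1 : R) * e₄ * m.c10 + (1 : R) * e₄ * m.c9 + (1 : R) * e₄ * m.c8 + (1 : R) * e₄ * m.c7 + (1 : R) * e₄ * m.c6 + (1 : R) * e₄ * m.c5 + (1 : R) *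 e₄ * m.c4 + (1 : R) * e₄ * m.c3 + (1 : R) * e₄ * m.c2 + (1 : R) * e₄ * m.c1

/-- The `e₀^1 e₁^0 e₂^1` part of the mass `T`. -/
def pgT101 (e₃ e₄ : R) (m : SCells R) : R :=
  (2 : R) * e₃ * e₄ * m.c8 + (1 : R) * e₃ * e₄ * m.c7 + (2 : R) * e₃ * e₄ * m.c5 + (1 : R) * e₃ * e₄ * m.c4 + (2 : R) * e₃ * e₄ * m.c2 + (1 : R) * e₃ * e₄ * m.c1 + (-1 : R) * e₃ * m.c8 + (-1 : R) * e₃ * m.c5 + (-1 : R) * e₃ * m.c2 + (-1 : R) * e₄ * m.c8 + (-1 : R) * e₄ * m.c7 + (-1 : R) * e₄ * m.c5 + (-1 : R) * e₄ * m.c4 + (-1 : R) * e₄ * m.c2 + (-1 : R) * e₄ * m.c1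

/-- The `e₀^1 e₁^1 e₂^0` part of the mass `T`. -/
def pgT110 (e₃ e₄ : R) (m : SCells R) : R :=
  (2 : R) * e₃ * e₄ * m.c8 + (2 : R) * e₃ * e₄ * m.c7 + (2 : R) * e₃ * e₄ * m.c6 + (1 : R) * e₃ * e₄ * m.c5 + (1 : R) * e₃ * e₄ * m.c4 + (1 : R) * e₃ * e₄ * m.c3 + (-1 : R) * e₃ * m.c8 + (-1 : R) * e₃ * m.c7 + (-1 : R) * e₃ * m.c6 + (-1 : R) * e₄ * m.c8 + (-1 : R) * e₄ * m.c7 + (-1 : R) * e₄ * m.c6 + (-1 : R) * e₄ * m.c5 + (-1 : R) * e₄ * m.c4 + (-1 : R) * e₄ * m.c3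

/-- The `e₀^1 e₁^1 e₂^1` part of the mass `T`. -/
def pgT111 (e₃ e₄ : R) (m : SCells R) : R :=
  (-2 : R) * e₃ * e₄ * m.c8 + (-2 : R) * e₃ * e₄ * m.c7 + (-2 : R) * e₃ * e₄ * m.c5 + (-1 : R) * e₃ * e₄ * m.c4 + (1 : R) * e₃ * m.c8 + (1 : R) * e₃ * m.c7 + (1 : R) * e₃ * m.c5 + (1 : R) * e₄ * m.c8 + (1 : R) * e₄ * m.c7 + (1 : R) * e₄ * m.c5 + (1 : R) * e₄ * m.c4

/-- The mass `T` is multilinear in `e₀, e₁, e₂`: its parts. -/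
lemma sgT_parts (e₀ e₁ e₂ e₃ e₄ : R) (m : SCells R) :
    sgT e₀ e₁ e₂ e₃ e₄ m = e₂ * pgT001 e₃ e₄ m + e₁ * pgT010 e₃ e₄ m + e₁ * e₂ * pgT011 e₃ e₄ m + e₀ * pgT100 e₃ e₄ m + e₀ * e₂ * pgT101 e₃ e₄ m + e₀ * e₁ * pgT110 e₃ e₄ m + e₀ * e₁ * e₂ * pgT111 e₃ e₄ m := by
  unfold sgT pgT001 pgT010 pgT011 pgT100 pgT101 pgT110 pgT111
  ring

/-- The `e₀^0 e₁^0 e₂^1` part of the mass `To`. -/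
def pgTo001 (e₃ e₄ : R) (m : SCells R) : R :=
  (-1 : R) * e₃ * e₄ * m.c8 + (-1 : R) * e₃ * e₄ * m.c5 + (1 : R) * m.c8 + (1 : R) * m.c5

/-- The `e₀^0 e₁^1 e₂^0` part of the mass `To`. -/
def pgTo010 (e₃ e₄ : R) (m : SCells R) : R :=
  (-1 : R) * e₃ * e₄ * m.c8 + (-1 : R) * e₃ * e₄ * m.c7 + (-1 : R) * e₃ * e₄ * m.c6 + (1 : R) * m.c8 + (1 : R) * m.c7 + (1 : R) * m.c6

/-- The `e₀^0 e₁^1 e₂^1` part of the mass `To`. -/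
def pgTo011 (e₃ e₄ : R) (m : SCells R) : R :=
  (1 : R) * e₃ * e₄ * m.c8 + (1 : R) * e₃ * e₄ * m.c7 + (1 : R) * e₃ * e₄ * m.c5 + (-1 : R) * e₃ * e₄ * m.c2 + (-1 : R) * m.c8 + (-1 : R) * m.c7 + (-1 : R) * m.c5 + (1 : R) * m.c2

/-- The `e₀^1 e₁^0 e₂^0` part of the mass `To`. -/
def pgTo100 (e₃ e₄ : R) (m : SCells R) : R :=
  (-1 : R) * e₃ * e₄ * m.c8 + (-1 : R) * e₃ * e₄ * m.c7 + (-1 : R) * e₃ * e₄ * m.c6 + (-1 : R) * e₃ * e₄ * m.c5 + (-1 : R) * e₃ * e₄ * m.c4 + (-1 : R) * e₃ * e₄ * m.c3 + (1 : R) * e₄ * m.c8 + (1 : R) * e₄ * m.c7 + (1 : R) * e₄ * m.c6 + (1 : R) * e₄ * m.c5 + (1 : R) * e₄ * m.c4 + (1 : R) * e₄ * m.c3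

/-- The `e₀^1 e₁^0 e₂^1` part of the mass `To`. -/
def pgTo101 (e₃ e₄ : R) (m : SCells R) : R :=
  (-1 : R) * e₃ * e₄ * m.c10 + (2 : R) * e₃ * e₄ * m.c8 + (1 : R) * e₃ * e₄ * m.c7 + (2 : R) * e₃ * e₄ * m.c5 + (1 : R) * e₃ * e₄ * m.c4 + (-1 : R) * e₃ * m.c8 + (-1 : R) * e₃ * m.c5 + (1 : R) * e₄ * m.c10 + (-1 : R) * e₄ * m.c8 + (-1 : R) * e₄ * m.c7 + (-1 : R) * e₄ * m.c5 + (-1 : R) * e₄ * m.c4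

/-- The `e₀^1 e₁^1 e₂^0` part of the mass `To`. -/
def pgTo110 (e₃ e₄ : R) (m : SCells R) : R :=
  (-1 : R) * e₃ * e₄ * m.c10 + (-1 : R) * e₃ * e₄ * m.c9 + (2 : R) * e₃ * e₄ * m.c8 + (2 : R) * e₃ * e₄ * m.c7 + (2 : R) * e₃ * e₄ * m.c6 + (1 : R) * e₃ * e₄ * m.c5 + (1 : R) * e₃ * e₄ * m.c4 + (1 : R) * e₃ * e₄ * m.c3 + (-1 : R) * e₃ * e₄ * m.c2 + (-1 : R) * e₃ * e₄ * m.c1 + (-1 : R) * e₃ * m.c8 + (-1 : R) * e₃ * m.c7 + (-1 : R) * e₃ * m.c6 + (1 : R) * e₄ * m.c10 + (1 : R) * e₄ * m.c9 + (-1 : R) * e₄ * m.c8 + (-1 : R) * e₄ * m.c7 + (-1 : R) * e₄ * m.c6 + (-1 : R) * e₄ * m.c5 + (-1 : R) * e₄ * m.c4 + (-1 : R) * e₄ * m.c3 + (1 : R) * e₄ * m.c2 + (1 : R) * e₄ * m.c1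

/-- The `e₀^1 e₁^1 e₂^1` part of the mass `To`. -/
def pgTo111 (e₃ e₄ : R) (m : SCells R) : R :=
  (1 : R) * e₃ * e₄ * m.c10 + (-2 : R) * e₃ * e₄ * m.c8 + (-2 : R) * e₃ * e₄ * m.c7 + (-2 : R) * e₃ * e₄ * m.c5 + (-1 : R) * e₃ * e₄ * m.c4 + (2 : R) * e₃ * e₄ * m.c2 + (1 : R) * e₃ * e₄ * m.c1 + (1 : R) * e₃ * m.c8 + (1 : R) * e₃ * m.c7 + (1 : R) * e₃ * m.c5 + (-1 : R) * e₃ * m.c2 + (-1 : R) * e₄ * m.c10 + (1 : R) * e₄ * m.c8 + (1 : R) * e₄ * m.c7 + (1 : R) * e₄ * m.c5 + (1 : R) * e₄ * m.c4 + (-1 : R) * e₄ * m.c2 + (-1 : R) * e₄ * m.c1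

/-- The mass `To` is multilinear in `e₀, e₁, e₂`: its parts. -/
lemma sgTo_parts (e₀ e₁ e₂ e₃ e₄ : R) (m : SCells R) :
    sgTo e₀ e₁ e₂ e₃ e₄ m = e₂ * pgTo001 e₃ e₄ m + e₁ * pgTo010 e₃ e₄ m + e₁ * e₂ * pgTo011 e₃ e₄ m + e₀ * pgTo100 e₃ e₄ m + e₀ * e₂ * pgTo101 e₃ e₄ m + e₀ * e₁ * pgTo110 e₃ e₄ m + e₀ * e₁ * e₂ * pgTo111 e₃ e₄ m := by
  unfold sgTo pgTo001 pgTo010 pgTo011 pgTo100 pgTo101 pgTo110 pgTo111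
  ring

end PartsTG5

end CaseOne

end Summit.Ventures.PercRepro2
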